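import Literature.AlgebraicGeometry.HodgeTheory.GysinTrivialFamilyBaseChange
import Literature.AlgebraicGeometry.HodgeTheory.SupportedClassesPurity
import Literature.AlgebraicGeometry.HodgeTheory.AlgebraicClassesHodgeTypeHolds
import Literature.AlgebraicGeometry.HodgeTheory.GysinFormalismCorrespondences
import Literature.AlgebraicGeometry.HodgeTheory.LefschetzOneOneChowClosed
import HarnessLib

/-!
# Clean-intersection base change for the Gysin morphisms: `f^* g_* = K • p_* q^*`

Family `hodge`, layer `Literature/AlgebraicGeometry/HodgeTheory`. W. Fulton, *Intersection Theory*
(1998), Thm. 6.2 (a) with Prop. 6.3 / Prop. 1.7, and §19.2 for the cohomological side: for a fibre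
square of smooth projective varieties

  `W —q→ Y`
  `p↓     ↓g`        `f^* g_* = p_* q^*`  when `W = Y ×_X X'` has the expected dimension
  `X' —f→ X`          `dim W = dim Y + dim X' − dim X` (no excess),

equivalently the multiplicativity of Thom / orientation classes under transversal intersection
(`[Y]|_{X'} = [Y ∩ X']`). This file proves the statement for the tree's Gysin morphisms
`complexGysin μ` (`ComplexGysin`: `D⁻¹ ∘ f(ℂ)_* ∘ D`, relative to an ARBITRARY orientation family
`μ` — a `ℂ`-orientation of each `X(ℂ)` determined only up to a unit, so that any identity between the
four unrelated members `μ_W, μ_Y, μ_X', μ_X` holds UP TO ONE SCALAR `K`, as for the tree's product base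
change `gysin_baseChange`):

* `complexGysin_cleanBaseChange` — **for smooth projective `Y, X, X', W` (dimensions `m, n, n', w`,
  `w + n = m + n'`), morphisms `g, f, q, p` as above with `(q, p) : W ⟶ Y ⊗ X'` a closed immersion
  whose complex points exhaust the incidence `{(P, Q) | g(P) = f(Q)}`, there is ONE `K ∈ ℂ` with
  `f^*(g_* y) = K • p_*(q^* y)` for all `y ∈ Hᵃ(Y(ℂ); ℂ)` and all degrees `a`;**
* `complexGysin_cleanBaseChange_ne_zero`, `complexGysin_cleanBaseChange_of_ne_zero` — `K ≠ 0` as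
  soon as `f^*(g_* 1) ≠ 0` (the degree-`0` instance pins `K`: `f^*[Y] = K • [p(W)]`);
* `isClosedImmersion_lift_left_of_isSmoothProjective`, `isClosedImmersion_graph_left` — `(q, p)` is a
  closed immersion when `q` is (e.g. a section), the graph `(𝟙, g)` always;
* `complexGysin_baseChange_of_commonSection` — the shape of two cone branches: `φ, ψ : E ⟶ X'` meeting
  exactly along a common section `σ` of `π : E ⟶ X`, `φ^*(ψ_* π^* w) = K • σ_* w` with `K ≠ 0`.

Neither the commutativity `q ≫ g = p ≫ f` nor smoothness of the scheme-theoretic fibre product is a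
hypothesis: `K` is the intersection number of `g(Y)` and `f(X')` along the irreducible `W` read in the
conventions of `μ` (it may vanish in degenerate situations, and is `deg (Y · X')/deg W` up to the units
of `μ` in general; `±1` for complex orientations and a transversal square — a local computation not
done here).

## Proof (the graph trick: product base change + purity in the critical degree)

(1) `g_* y = snd_*(fst^* y ∪ [Γ_g])`, `[Γ_g] = (𝟙, g)_* 1 ∈ H²ⁿ((Y ⊗ X)(ℂ))` (projection formula for
the graph, `complexGysin_eq_snd_gysin_graph`). (2) Base change of the trivial family `snd : Y ⊗ X → X`
along `f` (`gysin_trivialFamily_baseChange`): `f^* snd_* = c • snd_* (Y ◁ f)^*`. (3) `[Γ_g]` dies off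
the graph (`restrictCompl_complexGysin_eq_zero`), so `(Y ◁ f)^*[Γ_g]` dies off its preimage, whose
complex points are incidences, hence off `V = (q, p)(W)` (`restrictCompl_map_whiskerLeft_eq_zero_of_incidence`).
(4) `V` is closed, irreducible, of codimension `≥ m + n' − w = n`, the critical degree: by PURITY
(`exists_ker_restrictCompl_le_span_of_isIrreducible`, Fulton Lemma 19.1.1) the classes of
`H²ⁿ((Y ⊗ X')(ℂ))` dying off `V` form a line containing `(q,p)_* 1 ≠ 0` (Wirtinger,
`complexGysin_one_ne_zero_of_stalkMap_surjective`), so `(Y ◁ f)^*[Γ_g] = K' • (q,p)_* 1`.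
(5) `snd_*(fst^* y ∪ (q,p)_* 1) = snd_* (q,p)_* (q^* y) = p_* q^* y` (projection formula, functoriality).

Everything is proved; no definitions, no named facts.

## References

* [Fulton1998] W. Fulton, Intersection Theory, 2nd ed., Springer 1998, Prop. 1.7, Thm. 6.2 (a),
  Prop. 6.3, §19.1 Lemma 19.1.1, §19.2.
* [FultonYoungTableaux1997] W. Fulton, Young Tableaux, CUP 1997, Appendix B §B.1 (5)–(7), §B.3.
* [VoisinHodgeI2002] C. Voisin, Hodge Theory and Complex Algebraic Geometry I, CUP 2002, §11.1.2.
-/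

noncomputable section

open CategoryTheory AlgebraicGeometry MonoidalCategory CartesianMonoidalCategory
open Literature.AlgebraicGeometry.Motives
open Literature.AlgebraicTopology.SingularHomology

namespace Literature.AlgebraicGeometry.HodgeTheory

section HodgeTheory

variable {m n n' w : ℕ} {Y X X' W : SchemeOver ℂ}

/-! ### The graph of a morphism -/

/-- `(q, p) : W ⟶ Y ⊗ X'` is a closed immersion as soon as `q` is one and `X'` is smooth projective
(hence separated): `(q, p) ≫ fst = q` with `fst` separated. (The tree's
`isClosedImmersion_lift_left_of_left`, `TopHodgeClassesSpannedByPullbacksOfInputs`, asks for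
`[IsSeparated X'.hom]`; this copy takes the smooth projective hypothesis of the present file.)
[cite: Fulton1998, Prop. 1.7 and §16.1] -/
theorem isClosedImmersion_lift_left_of_isSmoothProjective (hX' : IsSmoothProjective n' X')
    (q : W ⟶ Y) [IsClosedImmersion q.left] (p : W ⟶ X') : IsClosedImmersion (lift q p).left := by
  haveI : IsProper X'.hom := IsSmoothProjective.isProper_holds hX'
  have h : (lift q p).left ≫ (fst Y X').left = q.left := by
    rw [← Over.comp_left, lift_fst]
  haveI : IsSeparated (fst Y X').left :=
    inferInstanceAs (IsSeparated (Limits.pullback.fst Y.hom X'.hom))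
  haveI : IsClosedImmersion ((lift q p).left ≫ (fst Y X').left) := by
    rw [h]
    infer_instance
  exact IsClosedImmersion.of_comp _ (fst Y X').left

/-- The graph `(𝟙, g) : Y ⟶ Y ⊗ X` of a morphism to a smooth projective (hence separated) `X` is a
closed immersion (a section of the separated projection `fst`). [cite: Fulton1998, Prop. 1.7 and §16.1] -/
theorem isClosedImmersion_graph_left (hX : IsSmoothProjective n X) (g : Y ⟶ X) :
    IsClosedImmersion (lift (𝟙 Y) g).left :=
  isClosedImmersion_lift_left_of_isSmoothProjective hX (𝟙 Y) g

/-- **`g_* y = snd_*(fst^* y ∪ [Γ_g])`** with `[Γ_g] = (𝟙, g)_* 1 ∈ H²ⁿ((Y ⊗ X)(ℂ); ℂ)`: `g = (𝟙, g) ≫ snd`,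
`(𝟙, g)_* y = (𝟙, g)_*((𝟙, g)^* fst^* y ∪ 1) = fst^* y ∪ (𝟙, g)_* 1` (functoriality and the
projection formula for the graph; Fulton §16.1, the graph of `g` as a correspondence acting by `g_*`).
[cite: Fulton1998, §16.1 Prop. 16.1.1 and Prop. 16.1.2] [cite: FultonYoungTableaux1997, Appendix B §B.1 (5)–(6)] -/
theorem complexGysin_eq_snd_gysin_graph (μ : OrientationFamily) (hY : IsSmoothProjective m Y)
    (hX : IsSmoothProjective n X) (g : Y ⟶ X) {a b : ℕ} (hab : a + 2 * n = b + 2 * m)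
    (y : complexBetti Y a) :
    complexGysin μ hY hX g hab y =
      complexGysin μ (IsSmoothProjective.tensor_holds hY hX) hX (snd Y X)
        (show a + 2 * n + 2 * n = b + 2 * (m + n) by omega)
        (cupProduct (rfl : a + 2 * n = a + 2 * n) (complexBetti.map (fst Y X) a y)
          (complexGysin μ hY (IsSmoothProjective.tensor_holds hY hX) (lift (𝟙 Y) g)
            (show 0 + 2 * (m + n) = 2 * n + 2 * m by omega)
            (singularCohomology.one ℂ (ComplexPoints Y)))) := by
  have hμ : μ.HasPoincareDuality := OrientationFamily.hasPoincareDuality μ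
  have hT := IsSmoothProjective.tensor_holds hY hX
  have key : complexGysin μ hY hX (lift (𝟙 Y) g ≫ snd Y X) hab y =
      complexGysin μ hT hX (snd Y X) (show a + 2 * n + 2 * n = b + 2 * (m + n) by omega)
        (cupProduct (rfl : a + 2 * n = a + 2 * n) (complexBetti.map (fst Y X) a y)
          (complexGysin μ hY hT (lift (𝟙 Y) g) (show 0 + 2 * (m + n) = 2 * n + 2 * m by omega)
            (singularCohomology.one ℂ (ComplexPoints Y)))) := by
    rw [complexGysin_comp hμ hY hT hX (lift (𝟙 Y) g) (snd Y X)
      (show a + 2 * (m + n) = a + 2 * n + 2 * m by omega)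
      (show a + 2 * n + 2 * n = b + 2 * (m + n) by omega), LinearMap.comp_apply]
    congr 1
    have h1 : complexBetti.map (lift (𝟙 Y) g) a (complexBetti.map (fst Y X) a y) = y := by
      rw [← CategoryTheory.comp_apply, ← complexBetti.map_comp, lift_fst, complexBetti.map_id]
      rfl
    have h2 := complexGysin_cup hμ hY hT (lift (𝟙 Y) g) (Nat.add_zero a)
      (show a + 2 * (m + n) = a + 2 * n + 2 * m by omega)
      (show 0 + 2 * (m + n) = 2 * n + 2 * m by omega) (rfl : a + 2 * n = a + 2 * n)
      (complexBetti.map (fst Y X) a y) (singularCohomology.one ℂ (ComplexPoints Y))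
    rw [h1, cupProduct_one] at h2
    exact h2
  have e : lift (𝟙 Y) g ≫ snd Y X = g := lift_snd _ _
  rw [e] at key
  exact key

/-! ### Incidences and the support of the pulled-back graph class -/

/-- **A class supported on the graph of `g` pulls back, along `Y ◁ f : Y ⊗ X' → Y ⊗ X`, to a class
supported on `(q, p)(W)`**, provided the complex points of `W` exhaust the incidences: every pair
`(P, Q) ∈ Y(ℂ) × X'(ℂ)` with `g(P) = f(Q)` is `(q(R), p(R))` for some `R ∈ W(ℂ)`. (The preimage of the
graph consists of incidences, `range_map_eq_setOf_pt_mem_range` for the closed immersion `(𝟙, g)`,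
and the points of `Y ⊗ X'` are pairs, `AlgPoints.prodEquiv`.) [cite: Fulton1998, Prop. 1.7 and Thm. 6.2 (a)] -/
theorem restrictCompl_map_whiskerLeft_eq_zero_of_incidence (hX : IsSmoothProjective n X)
    (g : Y ⟶ X) (f : X' ⟶ X) (q : W ⟶ Y) (p : W ⟶ X')
    (hinc : ∀ (P : ComplexPoints Y) (Q : ComplexPoints X'), AlgPoints.map g P = AlgPoints.map f Q →
      ∃ R : ComplexPoints W, AlgPoints.map q R = P ∧ AlgPoints.map p R = Q)
    {k : ℕ} {u : complexBetti (Y ⊗ X) k}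
    (hu : complexBetti.restrictCompl (Y ⊗ X) (Set.range (lift (𝟙 Y) g).left.base) k u = 0) :
    complexBetti.restrictCompl (Y ⊗ X') (Set.range (lift q p).left.base) k
      (complexBetti.map (Y ◁ f) k u) = 0 := by
  haveI := isClosedImmersion_graph_left hX g
  have h1 := complexBetti.restrictCompl_map_eq_zero (Y ◁ f) hu
  -- incidences are points of `(q, p)(W)`
  have hsub : ∀ P : ComplexPoints (Y ⊗ X'),
      P.pt ∈ (Y ◁ f).left.base ⁻¹' Set.range (lift (𝟙 Y) g).left.base →
        P.pt ∈ Set.range (lift q p).left.base := by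
    intro P hP
    have hP' : AlgPoints.map (Y ◁ f) P ∈
        {Q : ComplexPoints (Y ⊗ X) | Q.pt ∈ Set.range (lift (𝟙 Y) g).left.base} := hP
    rw [← range_map_eq_setOf_pt_mem_range (L := ℂ) (lift (𝟙 Y) g)] at hP'
    obtain ⟨y₀, hy₀⟩ := hP'
    have hfst : y₀ = AlgPoints.map (fst Y X') P := by
      have h := congrArg (AlgPoints.map (fst Y X)) hy₀
      rwa [← AlgPoints.map_comp_apply, lift_fst, AlgPoints.map_id_apply, ← AlgPoints.map_comp_apply,
        whiskerLeft_fst] at h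
    have hsnd : AlgPoints.map g y₀ = AlgPoints.map f (AlgPoints.map (snd Y X') P) := by
      have h := congrArg (AlgPoints.map (snd Y X)) hy₀
      rwa [← AlgPoints.map_comp_apply, lift_snd, ← AlgPoints.map_comp_apply, whiskerLeft_snd,
        AlgPoints.map_comp_apply] at h
    rw [hfst] at hsnd
    obtain ⟨R, hRq, hRp⟩ := hinc _ _ hsnd
    have hR : AlgPoints.map (lift q p) R = P := by
      apply AlgPoints.prodEquiv.injective
      refine Prod.ext ?_ ?_
      · rw [AlgPoints.prodEquiv_apply_fst, AlgPoints.prodEquiv_apply_fst, ← AlgPoints.map_comp_apply,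
          lift_fst, hRq]
      · rw [AlgPoints.prodEquiv_apply_snd, AlgPoints.prodEquiv_apply_snd, ← AlgPoints.map_comp_apply,
          lift_snd, hRp]
    rw [← hR, AlgPoints.pt_map]
    exact ⟨R.pt, rfl⟩
  -- restrict further along the inclusion of complements
  let ι : C(complexPointsCompl (Y ⊗ X') (Set.range (lift q p).left.base),
      complexPointsCompl (Y ⊗ X') ((Y ◁ f).left.base ⁻¹' Set.range (lift (𝟙 Y) g).left.base)) :=
    ⟨fun P ↦ ⟨P.1, fun hP ↦ P.2 (hsub P.1 hP)⟩, by fun_prop⟩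
  have hcomp : (⟨Subtype.val, continuous_subtype_val⟩ :
      C(complexPointsCompl (Y ⊗ X') (Set.range (lift q p).left.base), ComplexPoints (Y ⊗ X'))) =
      (⟨Subtype.val, continuous_subtype_val⟩ :
        C(complexPointsCompl (Y ⊗ X') ((Y ◁ f).left.base ⁻¹' Set.range (lift (𝟙 Y) g).left.base),
          ComplexPoints (Y ⊗ X'))).comp ι := rfl
  change singularCohomology.map ℂ ℂ _ k _ = 0
  rw [hcomp, singularCohomology.map_comp, CategoryTheory.comp_apply]
  change singularCohomology.map ℂ ℂ ι k (complexBetti.restrictCompl (Y ⊗ X')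
    ((Y ◁ f).left.base ⁻¹' Set.range (lift (𝟙 Y) g).left.base) k (complexBetti.map (Y ◁ f) k u)) = 0
  rw [h1, map_zero]

/-- Two vectors on a line, the second non-zero, are proportional. [folklore] -/
theorem exists_eq_smul_of_mem_span_singleton {V : Type*} [AddCommGroup V] [Module ℂ V]
    {τ x₁ x₂ : V} (h₁ : x₁ ∈ Submodule.span ℂ ({τ} : Set V)) (h₂ : x₂ ∈ Submodule.span ℂ ({τ} : Set V))
    (hx₂ : x₂ ≠ 0) : ∃ K : ℂ, x₁ = K • x₂ := by
  obtain ⟨a, rfl⟩ := Submodule.mem_span_singleton.1 h₁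
  obtain ⟨b, rfl⟩ := Submodule.mem_span_singleton.1 h₂
  have hb : b ≠ 0 := by
    rintro rfl
    exact hx₂ (zero_smul _ _)
  exact ⟨a * b⁻¹, by rw [smul_smul, inv_mul_cancel_right₀ hb]⟩

/-! ### The base change -/

/-- **Clean-intersection base change for the Gysin morphisms, up to the orientation scalar**
(Fulton, *Intersection Theory*, Thm. 6.2 (a) / Prop. 6.3 with Prop. 1.7; §19.2). Let `Y, X, X', W`
be smooth projective complex varieties of dimensions `m, n, n', w` with `w + n = m + n'`, let
`g : Y ⟶ X`, `f : X' ⟶ X`, `q : W ⟶ Y`, `p : W ⟶ X'`, suppose `(q, p) : W ⟶ Y ⊗ X'` is a closed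
immersion and that every incidence `g(P) = f(Q)` of complex points is `(P, Q) = (q(R), p(R))` for some
`R ∈ W(ℂ)` (so `W ≅ (Y ×_X X')_red` set-theoretically, of the expected dimension). Then for every
orientation family `μ` there is ONE scalar `K ∈ ℂ` with

  `f^*(g_* y) = K • p_*(q^* y)`   for all `y ∈ Hᵃ(Y(ℂ); ℂ)`, all `a` (`a + 2n = b + 2m`).

`K` is the multiplicity of the intersection read in the conventions of `μ` (`±1` for complex
orientations and a transversal square); `K ≠ 0 ⟺ f^*(g_* 1) ≠ 0` when `p_* 1 ≠ 0`
(`complexGysin_cleanBaseChange_ne_zero`). Proof: the graph trick of the module docstring — product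
base change (`gysin_trivialFamily_baseChange`), purity of the classes supported on the irreducible
`(q,p)(W)` in the critical degree `2n` (`exists_ker_restrictCompl_le_span_of_isIrreducible`), Wirtinger
(`complexGysin_one_ne_zero_of_stalkMap_surjective`) and the projection formula.
[cite: Fulton1998, Thm. 6.2 (a), Prop. 6.3, Prop. 1.7 and §19.2] [cite: FultonYoungTableaux1997, Appendix B §B.1 (5)–(7)]
[cite: VoisinHodgeI2002, §11.1.2 Lemma 11.13] -/
theorem complexGysin_cleanBaseChange (μ : OrientationFamily)
    (hY : IsSmoothProjective m Y) (hX : IsSmoothProjective n X) (hX' : IsSmoothProjective n' X')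
    (hW : IsSmoothProjective w W) (g : Y ⟶ X) (f : X' ⟶ X) (q : W ⟶ Y) (p : W ⟶ X')
    (hdim : w + n = m + n') [IsClosedImmersion (lift q p).left]
    (hinc : ∀ (P : ComplexPoints Y) (Q : ComplexPoints X'), AlgPoints.map g P = AlgPoints.map f Q →
      ∃ R : ComplexPoints W, AlgPoints.map q R = P ∧ AlgPoints.map p R = Q) :
    ∃ K : ℂ, ∀ ⦃a b : ℕ⦄ (hab : a + 2 * n = b + 2 * m) (y : complexBetti Y a),
      complexBetti.map f b (complexGysin μ hY hX g hab y) =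
        K • complexGysin μ hW hX' p (show a + 2 * n' = b + 2 * w by omega) (complexBetti.map q a y) := by
  have hμ : μ.HasPoincareDuality := OrientationFamily.hasPoincareDuality μ
  have hT := IsSmoothProjective.tensor_holds hY hX
  have hT' := IsSmoothProjective.tensor_holds hY hX'
  haveI := isClosedImmersion_graph_left hX g
  -- the graph class `γ = [Γ_g]` and the class `δ = (q,p)_* 1`
  set γ : complexBetti (Y ⊗ X) (2 * n) := complexGysin μ hY hT (lift (𝟙 Y) g)
    (show 0 + 2 * (m + n) = 2 * n + 2 * m by omega) (singularCohomology.one ℂ (ComplexPoints Y)) with hγ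
  set δ : complexBetti (Y ⊗ X') (2 * n) := complexGysin μ hW hT' (lift q p)
    (show 0 + 2 * (m + n') = 2 * n + 2 * w by omega) (singularCohomology.one ℂ (ComplexPoints W)) with hδ
  set V : Set (Y ⊗ X').left := Set.range (lift q p).left.base with hV
  -- (3) supports
  have hγ0 : complexBetti.restrictCompl (Y ⊗ X) (Set.range (lift (𝟙 Y) g).left.base) (2 * n) γ = 0 :=
    restrictCompl_complexGysin_eq_zero (gysinMap_restrictCompl_eq_zero_of_field ℂ) μ hμ hT hY
      (lift (𝟙 Y) g) (lift (𝟙 Y) g).left.isClosedEmbedding.isClosed_range subset_rfl _ _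
  have hFγ : complexBetti.restrictCompl (Y ⊗ X') V (2 * n) (complexBetti.map (Y ◁ f) (2 * n) γ) = 0 :=
    restrictCompl_map_whiskerLeft_eq_zero_of_incidence hX g f q p hinc hγ0
  have hVc : IsClosed V := (lift q p).left.isClosedEmbedding.isClosed_range
  have hδ0 : complexBetti.restrictCompl (Y ⊗ X') V (2 * n) δ = 0 :=
    restrictCompl_complexGysin_eq_zero (gysinMap_restrictCompl_eq_zero_of_field ℂ) μ hμ hT' hW
      (lift q p) hVc subset_rfl _ _
  -- (4) `δ ≠ 0` (Wirtinger at a complex point of the closed immersion `(q, p)`)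
  haveI := connectedSpace_complexPoints hW
  obtain ⟨P⟩ := (inferInstance : Nonempty (ComplexPoints W))
  have hδne : δ ≠ 0 :=
    complexGysin_one_ne_zero_of_stalkMap_surjective μ hT' hW (lift q p) P
      ((lift q p).left.stalkMap_surjective P.pt) hdim
  -- (4) purity: the classes of `H²ⁿ((Y ⊗ X')(ℂ))` dying off `V` lie on a line
  obtain ⟨τ, hτ⟩ : ∃ τ : complexBetti (Y ⊗ X') (2 * n),
      LinearMap.ker (complexBetti.restrictCompl (Y ⊗ X') V (2 * n)).hom ≤ Submodule.span ℂ {τ} := by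
    rcases Nat.eq_zero_or_pos n with rfl | hn
    · refine ⟨singularCohomology.one ℂ _, fun x _ ↦ ?_⟩
      obtain ⟨t, ht⟩ := exists_eq_smul_one μ hT' x
      exact Submodule.mem_span_singleton.2 ⟨t, ht.symm⟩
    · haveI := irreducibleSpace_of_isSmoothProjective' hW
      have hVi : IsIrreducible V := by
        have h := (IrreducibleSpace.isIrreducible_univ (↥(W.left))).image (lift q p).left.base
          (lift q p).left.base.hom.continuous.continuousOn
        rwa [Set.image_univ] at h
      have hcod : ∀ v ∈ V, (n : ℕ∞) ≤ Order.coheight v := fun v hv ↦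
        le_coheight_of_mem_image hW hT' (lift q p) (lift q p).left.isClosedEmbedding.isClosedMap
          (S := Set.univ) (r := 0) (s := n) (fun _ _ ↦ by simp) (by omega)
          (by rwa [Set.image_univ])
      exact exists_ker_restrictCompl_le_span_of_isIrreducible hT' hVc hVi hn hcod
  obtain ⟨K', hK'⟩ : ∃ K' : ℂ, complexBetti.map (Y ◁ f) (2 * n) γ = K' • δ :=
    exists_eq_smul_of_mem_span_singleton (hτ (LinearMap.mem_ker.2 hFγ)) (hτ (LinearMap.mem_ker.2 hδ0))
      hδne
  -- (2) base change of the trivial family along `f`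
  obtain ⟨c, hc⟩ := gysin_trivialFamily_baseChange μ hY hX hX' f
  refine ⟨c * K', fun a b hab y ↦ ?_⟩
  -- (1) + (2) + (4)
  rw [complexGysin_eq_snd_gysin_graph μ hY hX g hab y,
    hc (show a + 2 * n + 2 * n = b + 2 * (m + n) by omega), cupProduct_map, ← hγ, hK',
    LinearMap.map_smul, LinearMap.map_smul, smul_smul]
  congr 1
  -- (5) `snd_*(fst^* y ∪ (q,p)_* 1) = p_* q^* y`
  have h3 := complexGysin_cup hμ hW hT' (lift q p) (Nat.add_zero a)
    (show a + 2 * (m + n') = a + 2 * n + 2 * w by omega)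
    (show 0 + 2 * (m + n') = 2 * n + 2 * w by omega) (rfl : a + 2 * n = a + 2 * n)
    (complexBetti.map (fst Y X') a y) (singularCohomology.one ℂ (ComplexPoints W))
  have h4 : complexBetti.map (lift q p) a (complexBetti.map (fst Y X') a y) = complexBetti.map q a y := by
    rw [← CategoryTheory.comp_apply, ← complexBetti.map_comp, lift_fst]
  rw [h4, cupProduct_one, ← hδ] at h3
  have h5 : complexBetti.map (Y ◁ f) a (complexBetti.map (fst Y X) a y) =
      complexBetti.map (fst Y X') a y := by
    rw [← CategoryTheory.comp_apply, ← complexBetti.map_comp, whiskerLeft_fst]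
  rw [h5, ← h3, ← LinearMap.comp_apply (f := complexGysin μ hT' hX' (snd Y X') _),
    ← complexGysin_comp hμ hW hT' hX' (lift q p) (snd Y X')
      (show a + 2 * (m + n') = a + 2 * n + 2 * w by omega)
      (show a + 2 * n + 2 * n' = b + 2 * (m + n') by omega)]
  have e : lift q p ≫ snd Y X' = p := lift_snd _ _
  simp only [e]

/-- **The scalar is non-zero when `f^*[Y] ≠ 0`**: in the situation of
`complexGysin_cleanBaseChange`, if `f^*(g_* 1) ≠ 0` in `H^{2(n-m)}(X'(ℂ))` then `K ≠ 0` (the instance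
`y = 1`, `a = 0` of the base change reads `f^*(g_* 1) = K • p_* 1`). [cite: Fulton1998, Thm. 6.2 (a) and §19.2] -/
theorem complexGysin_cleanBaseChange_ne_zero {μ : OrientationFamily}
    {hY : IsSmoothProjective m Y} {hX : IsSmoothProjective n X} {hX' : IsSmoothProjective n' X'}
    {hW : IsSmoothProjective w W} {g : Y ⟶ X} {f : X' ⟶ X} {q : W ⟶ Y} {p : W ⟶ X'}
    (hdim : w + n = m + n') {K : ℂ}
    (hK : ∀ ⦃a b : ℕ⦄ (hab : a + 2 * n = b + 2 * m) (y : complexBetti Y a),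
      complexBetti.map f b (complexGysin μ hY hX g hab y) =
        K • complexGysin μ hW hX' p (show a + 2 * n' = b + 2 * w by omega) (complexBetti.map q a y))
    {b : ℕ} (hb : 0 + 2 * n = b + 2 * m)
    (h1 : complexBetti.map f b (complexGysin μ hY hX g hb (singularCohomology.one ℂ (ComplexPoints Y))) ≠ 0) :
    K ≠ 0 := by
  rintro rfl
  exact h1 (by rw [hK hb, zero_smul])

/-- **Clean base change with a non-zero scalar**: under the hypotheses of
`complexGysin_cleanBaseChange`, if moreover `f^*(g_* 1) ≠ 0` (the class of `g(Y)` restricts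
non-trivially to `X'`), then `f^*(g_* y) = K • p_*(q^* y)` for all `y`, with ONE `K ≠ 0` — the form
consumed by non-vanishing arguments (`π_* p_* q^* = K⁻¹ • π_* f^* g_*`).
[cite: Fulton1998, Thm. 6.2 (a), Prop. 6.3 and §19.2] -/
theorem complexGysin_cleanBaseChange_of_ne_zero (μ : OrientationFamily)
    (hY : IsSmoothProjective m Y) (hX : IsSmoothProjective n X) (hX' : IsSmoothProjective n' X')
    (hW : IsSmoothProjective w W) (g : Y ⟶ X) (f : X' ⟶ X) (q : W ⟶ Y) (p : W ⟶ X')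
    (hdim : w + n = m + n') [IsClosedImmersion (lift q p).left]
    (hinc : ∀ (P : ComplexPoints Y) (Q : ComplexPoints X'), AlgPoints.map g P = AlgPoints.map f Q →
      ∃ R : ComplexPoints W, AlgPoints.map q R = P ∧ AlgPoints.map p R = Q)
    {b₀ : ℕ} (hb₀ : 0 + 2 * n = b₀ + 2 * m)
    (h1 : complexBetti.map f b₀
      (complexGysin μ hY hX g hb₀ (singularCohomology.one ℂ (ComplexPoints Y))) ≠ 0) :
    ∃ K : ℂ, K ≠ 0 ∧ ∀ ⦃a b : ℕ⦄ (hab : a + 2 * n = b + 2 * m) (y : complexBetti Y a),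
      complexBetti.map f b (complexGysin μ hY hX g hab y) =
        K • complexGysin μ hW hX' p (show a + 2 * n' = b + 2 * w by omega) (complexBetti.map q a y) := by
  obtain ⟨K, hK⟩ := complexGysin_cleanBaseChange μ hY hX hX' hW g f q p hdim hinc
  exact ⟨K, complexGysin_cleanBaseChange_ne_zero hdim hK hb₀ h1, hK⟩

/-! ### Two morphisms from one variety meeting along a common section (cone branches) -/

/-- **Base change for two morphisms `φ, ψ : E ⟶ X'` meeting exactly along a common section.** Let
`π : E ⟶ X` have a section `σ : X ⟶ E` (`σ ≫ π = 𝟙`, a closed immersion), `E, X', X` smooth projective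
of dimensions `e, n', d` with `d + n' = 2e`, and let `φ, ψ : E ⟶ X'` be such that every incidence
`ψ(P) = φ(Q)` of complex points is `P = Q = σ(R)` (the images meet exactly along `σ(X)`, each point of
which has one preimage under `φ` and under `ψ`), with `φ^*(ψ_* 1) ≠ 0`. Then there is ONE `K ≠ 0` with

  `φ^*(ψ_*(π^* w)) = K • σ_* w`   for all `w ∈ Hᵃ(X(ℂ); ℂ)`

(`complexGysin_cleanBaseChange_of_ne_zero` for the square `W = X`, `q = p = σ`, and `σ^* π^* = 𝟙`). This is
the transversality input for the two branches `C_1 = φ(E)`, `C_ε = ψ(E)` of a cone over `X ⊂ X'` with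
distinct vertices, meeting along the base `σ(X)` (Aoki 1987, Thm. 1-4 (i) with `r = 0`: cone spans).
[cite: Fulton1998, Thm. 6.2 (a), Prop. 6.3 and §19.2] -/
theorem complexGysin_baseChange_of_commonSection (μ : OrientationFamily) {e d : ℕ} {E : SchemeOver ℂ}
    (hE : IsSmoothProjective e E) (hX' : IsSmoothProjective n' X') (hX : IsSmoothProjective d X)
    (π : E ⟶ X) (σ : X ⟶ E) (hσ : σ ≫ π = 𝟙 X) [IsClosedImmersion σ.left] (φ ψ : E ⟶ X')
    (hdim : d + n' = e + e)
    (hinc : ∀ (P Q : ComplexPoints E), AlgPoints.map ψ P = AlgPoints.map φ Q →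
      ∃ R : ComplexPoints X, AlgPoints.map σ R = P ∧ AlgPoints.map σ R = Q)
    {b₀ : ℕ} (hb₀ : 0 + 2 * n' = b₀ + 2 * e)
    (h1 : complexBetti.map φ b₀
      (complexGysin μ hE hX' ψ hb₀ (singularCohomology.one ℂ (ComplexPoints E))) ≠ 0) :
    ∃ K : ℂ, K ≠ 0 ∧ ∀ ⦃a b : ℕ⦄ (hab : a + 2 * n' = b + 2 * e) (w : complexBetti X a),
      complexBetti.map φ b (complexGysin μ hE hX' ψ hab (complexBetti.map π a w)) =
        K • complexGysin μ hX hE σ (show a + 2 * e = b + 2 * d by omega) w := by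
  haveI : IsClosedImmersion (lift σ σ).left := isClosedImmersion_lift_left_of_isSmoothProjective hE σ σ
  obtain ⟨K, hK0, hK⟩ :=
    complexGysin_cleanBaseChange_of_ne_zero μ hE hX' hE hX ψ φ σ σ hdim hinc hb₀ h1
  refine ⟨K, hK0, fun a b hab w ↦ ?_⟩
  rw [hK hab, ← CategoryTheory.comp_apply (f := complexBetti.map π a), ← complexBetti.map_comp, hσ,
    complexBetti.map_id]
  rfl

end HodgeTheory

end Literature.AlgebraicGeometry.HodgeTheory

end
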